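import Mathlib
import Literature.MathematicalPhysics.KineticTheory.HardSphereEuler
import Literature.Barriers.AnomalousDissipation.CodimensionOneRigiditySmoothing
import Summits.AtomisticToContinuum.HydrodynamicLimit.Theses.JParityClosure
import HarnessLib

/-!
# JParityClosure / ParityInBand — helper: it suffices to test the hydrodynamic fields against
# smooth functions

The conclusion of `Summit.AtomisticToContinuum.HydrodynamicLimit.Theses.JParityClosure.ParityInBand`
(verbatim `HydroLimitInBand`) is `TendstoHydroFieldsAt … t`: convergence in probability of the
empirical density / momentum / energy fields tested against EVERY continuous `χ : 𝕋³ → ℝ`. Every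
PDE-side engine (weak forms, BF18) produces statements for SMOOTH test functions. This file proves
the reduction: if the three convergences hold for all `Torus.IsSmooth χ`, and the empirical kinetic
energy at time `t` is tight (a consequence of energy conservation and the `t = 0` law of large
numbers), then `TendstoHydroFieldsAt … t` holds. Ingredients: uniform density of smooth functions in
`C(𝕋³)` (from the tree's space–time mollification lemma
`CodimensionOneRigidity.exists_smooth_near`) and the elementary bounds
`|⟨μ_z, (χ-χ̃)⟩| ≤ ‖χ-χ̃‖_∞`, `‖⟨μ_z, (χ-χ̃) v⟩‖ ≤ ‖χ-χ̃‖_∞ (1/2 + e_z)`,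
`|⟨μ_z, (χ-χ̃)|v|²/2⟩| ≤ ‖χ-χ̃‖_∞ e_z` for the empirical measure `μ_z` with kinetic energy `e_z`.
-/

namespace Summit.AtomisticToContinuum.HydrodynamicLimit.Theorems

open Set MeasureTheory Filter Topology
open scoped ENNReal
open Literature.MathematicalPhysics.KineticTheory Literature.Analysis.FluidPDE
open Literature.Analysis.FunctionSpaces

/-- **Smooth functions are uniformly dense in `C(𝕋ᵈ)`.** Every continuous `χ : 𝕋ᵈ → ℝ` is
uniformly `δ`-close to a `Torus.IsSmooth` function (time-slice at `0` of the space–time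
mollification of `(s, x) ↦ (1 - |s|)₊ χ x`, `CodimensionOneRigidity.exists_smooth_near`).
[folklore] -/
theorem exists_isSmooth_near {d : Type*} [Fintype d] {χ : UnitAddTorus d → ℝ} (hχ : Continuous χ)
    {δ : ℝ} (hδ : 0 < δ) :
    ∃ ψ : UnitAddTorus d → ℝ, Torus.IsSmooth ψ ∧ ∀ x, |ψ x - χ x| ≤ δ := by
  set g : ℝ × UnitAddTorus d → ℝ := fun p => max 0 (1 - |p.1|) * χ p.2 with hg
  have hgc : Continuous g :=
    (continuous_const.max (continuous_const.sub (continuous_abs.comp continuous_fst))).mul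
      (hχ.comp continuous_snd)
  have hgs : HasCompactSupport g := by
    refine HasCompactSupport.intro (isCompact_Icc.prod isCompact_univ :
      IsCompact (Icc (-1 : ℝ) 1 ×ˢ (univ : Set (UnitAddTorus d)))) fun p hp => ?_
    have hp1 : p.1 ∉ Icc (-1 : ℝ) 1 := fun h => hp ⟨h, mem_univ _⟩
    have : 1 - |p.1| ≤ 0 := by
      rcases not_and_or.1 (fun h => hp1 ⟨h.1, h.2⟩) with h | h
      · have : p.1 < -1 := not_le.1 h
        have : 1 < |p.1| := by rw [abs_of_neg (by linarith)]; linarith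
        linarith
      · have : 1 < p.1 := not_le.1 h
        have : 1 < |p.1| := by rw [abs_of_pos (by linarith)]; linarith
        linarith
    simp [hg, max_eq_left this]
  obtain ⟨χst, hsmooth, -, hclose⟩ :=
    Literature.Barriers.AnomalousDissipation.CodimensionOneRigidity.exists_smooth_near hgc hgs hδ
  refine ⟨χst 0, ?_, fun x => ?_⟩
  · have : Torus.lift (χst 0) = Torus.stLift χst ∘ fun y => ((0 : ℝ), y) := by
      funext y; rfl
    unfold Torus.IsSmooth
    rw [this]
    exact hsmooth.comp (contDiff_const.prodMk contDiff_id)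
  · have := hclose 0 x
    simpa [hg] using this

/-- Integration of a vector-valued function against the empirical measure:
`∫ φ dμ_z = N⁻¹ • ∑ᵢ φ(zᵢ)` (the tree's `integral_empiricalMeasure` is the real-valued case).
[folklore] -/
theorem integral_empiricalMeasure_vec {E : Type*} [NormedAddCommGroup E] [NormedSpace ℝ E]
    [CompleteSpace E] {N : ℕ} (z : Config N (Fin 3) T3) (φ : T3 × V3 → E) :
    ∫ y, φ y ∂empiricalMeasure z = (N : ℝ)⁻¹ • ∑ i, φ (z i) := by
  rw [empiricalMeasure, integral_smul_measure, integral_finsetSum_measure]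
  · simp [integral_dirac, ENNReal.toReal_inv]
  · exact fun i _ => integrable_dirac (by simp)

/-- Pointwise inequality `‖v‖ ≤ 1/2 + ‖v‖²/2`. [folklore] -/
theorem norm_le_half_add_half_sq {E : Type*} [SeminormedAddCommGroup E] (v : E) :
    ‖v‖ ≤ 1 / 2 + ‖v‖ ^ 2 / 2 := by
  nlinarith [sq_nonneg (‖v‖ - 1), norm_nonneg v]

/-- **Perturbing the test function in the empirical fields.** For a configuration `z` of `N + 1`
particles and test functions `χ, ψ` with `|ψ x - χ x| ≤ δ'` everywhere: the empirical density fields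
differ by at most `δ'`, the momentum fields by at most `δ' (1/2 + e_z)` and the energy fields by at
most `δ' e_z`, where `e_z = empiricalEnergyField z 1` is the empirical kinetic energy. [folklore] -/
theorem empiricalFields_sub_le {N : ℕ} (z : Config (N + 1) (Fin 3) T3) {χ ψ : T3 → ℝ} {δ' : ℝ}
    (hclose : ∀ x, |ψ x - χ x| ≤ δ') :
    |empiricalDensityField z ψ - empiricalDensityField z χ| ≤ δ' ∧
    ‖empiricalMomentumField z ψ - empiricalMomentumField z χ‖ ≤
      δ' * (1 / 2 + empiricalEnergyField z (fun _ => 1)) ∧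
    |empiricalEnergyField z ψ - empiricalEnergyField z χ| ≤
      δ' * empiricalEnergyField z (fun _ => 1) := by
  have hδ' : 0 ≤ δ' := (abs_nonneg _).trans (hclose 0)
  have hN : (0 : ℝ) < (N + 1 : ℕ) := by positivity
  have hNinv : (0 : ℝ) ≤ ((N + 1 : ℕ) : ℝ)⁻¹ := by positivity
  simp only [empiricalDensityField, empiricalMomentumField, empiricalEnergyField,
    integral_empiricalMeasure, integral_empiricalMeasure_vec]
  refine ⟨?_, ?_, ?_⟩
  · rw [← mul_sub, ← Finset.sum_sub_distrib, abs_mul, abs_of_nonneg hNinv]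
    calc ((N + 1 : ℕ) : ℝ)⁻¹ * |∑ i, (ψ (z i).1 - χ (z i).1)|
        ≤ ((N + 1 : ℕ) : ℝ)⁻¹ * ∑ i : Fin (N + 1), δ' := by
          refine mul_le_mul_of_nonneg_left ((Finset.abs_sum_le_sum_abs _ _).trans
            (Finset.sum_le_sum fun i _ => hclose _)) hNinv
      _ = δ' := by
          rw [Finset.sum_const, Finset.card_univ, Fintype.card_fin, nsmul_eq_mul]
          field_simp
  · rw [← smul_sub, ← Finset.sum_sub_distrib, norm_smul, Real.norm_eq_abs, abs_of_nonneg hNinv]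
    have hterm : ∀ i : Fin (N + 1), ‖ψ (z i).1 • (z i).2 - χ (z i).1 • (z i).2‖ ≤
        δ' * (1 / 2 + ‖(z i).2‖ ^ 2 / 2) := fun i => by
      rw [← sub_smul, norm_smul, Real.norm_eq_abs]
      exact mul_le_mul (hclose _) (norm_le_half_add_half_sq _) (norm_nonneg _) hδ'
    calc ((N + 1 : ℕ) : ℝ)⁻¹ * ‖∑ i, (ψ (z i).1 • (z i).2 - χ (z i).1 • (z i).2)‖
        ≤ ((N + 1 : ℕ) : ℝ)⁻¹ * ∑ i, δ' * (1 / 2 + ‖(z i).2‖ ^ 2 / 2) :=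
          mul_le_mul_of_nonneg_left ((norm_sum_le _ _).trans (Finset.sum_le_sum fun i _ =>
            hterm i)) hNinv
      _ = δ' * (1 / 2 + ((N + 1 : ℕ) : ℝ)⁻¹ * ∑ i, 1 * (‖(z i).2‖ ^ 2 / 2)) := by
          rw [← Finset.mul_sum, Finset.sum_add_distrib, Finset.sum_const, Finset.card_univ,
            Fintype.card_fin, nsmul_eq_mul]
          simp only [one_mul]
          field_simp
  · rw [← mul_sub, ← Finset.sum_sub_distrib, abs_mul, abs_of_nonneg hNinv]
    have hterm : ∀ i : Fin (N + 1), |ψ (z i).1 * (‖(z i).2‖ ^ 2 / 2) - χ (z i).1 * (‖(z i).2‖ ^ 2 / 2)|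
        ≤ δ' * (‖(z i).2‖ ^ 2 / 2) := fun i => by
      have h2 : (0 : ℝ) ≤ ‖(z i).2‖ ^ 2 / 2 := by positivity
      rw [← sub_mul, abs_mul, abs_of_nonneg h2]
      exact mul_le_mul_of_nonneg_right (hclose _) h2
    calc ((N + 1 : ℕ) : ℝ)⁻¹ * |∑ i, (ψ (z i).1 * (‖(z i).2‖ ^ 2 / 2) - χ (z i).1 * (‖(z i).2‖ ^ 2 / 2))|
        ≤ ((N + 1 : ℕ) : ℝ)⁻¹ * ∑ i, δ' * (‖(z i).2‖ ^ 2 / 2) :=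
          mul_le_mul_of_nonneg_left ((Finset.abs_sum_le_sum_abs _ _).trans
            (Finset.sum_le_sum fun i _ => hterm i)) hNinv
      _ = δ' * (((N + 1 : ℕ) : ℝ)⁻¹ * ∑ i, 1 * (‖(z i).2‖ ^ 2 / 2)) := by
          rw [← Finset.mul_sum]
          simp only [one_mul]
          ring


/-- A sequence in `ℝ≥0∞` tends to `0` if, for every `η > 0`, it is eventually bounded by a null
sequence plus `η`. [folklore] -/
theorem ENNReal.tendsto_zero_of_forall_le_add {A : ℕ → ℝ≥0∞}
    (h : ∀ η : ℝ, 0 < η → ∃ B : ℕ → ℝ≥0∞, Tendsto B atTop (𝓝 0) ∧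
      ∀ᶠ N in atTop, A N ≤ B N + ENNReal.ofReal η) :
    Tendsto A atTop (𝓝 0) := by
  rw [ENNReal.tendsto_nhds_zero]
  intro e he
  rcases eq_or_ne e ⊤ with htop | htop
  · exact Eventually.of_forall fun N => htop ▸ le_top
  have hepos : 0 < e.toReal := ENNReal.toReal_pos he.ne' htop
  obtain ⟨B, hB, hAB⟩ := h (e.toReal / 2) (by positivity)
  have hη : (0 : ℝ≥0∞) < ENNReal.ofReal (e.toReal / 2) := by
    rw [ENNReal.ofReal_pos]; positivity
  filter_upwards [hAB, (ENNReal.tendsto_nhds_zero.1 hB) _ hη] with N h1 h2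
  calc A N ≤ B N + ENNReal.ofReal (e.toReal / 2) := h1
    _ ≤ ENNReal.ofReal (e.toReal / 2) + ENNReal.ofReal (e.toReal / 2) := add_le_add h2 le_rfl
    _ = e := by
      rw [← ENNReal.ofReal_add (by positivity) (by positivity), add_halves, ENNReal.ofReal_toReal htop]

/-- A continuous real function on the compact torus is bounded. [folklore] -/
theorem exists_abs_le_of_continuous_T3 {f : T3 → ℝ} (hf : Continuous f) :
    ∃ B : ℝ, 0 ≤ B ∧ ∀ x, |f x| ≤ B := by
  obtain ⟨C, hC⟩ := isCompact_univ.exists_bound_of_continuousOn hf.continuousOn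
  exact ⟨max C 0, le_max_right _ _, fun x => (hC x (mem_univ x)).trans (le_max_left _ _)⟩

/-- **It suffices to test the hydrodynamic fields against smooth functions.** Let `P N` be laws on
`(N+1)`-particle phase space, `Φ N` hard-sphere flows and `(ρ, u, θ)` fields continuous in `x` at
time `t`. Assume (i) the empirical kinetic energy at time `t` is tight — for every `η > 0` some
level `K` is exceeded with `P N`-probability at most `η` for all large `N` (for hard spheres: energy
conservation plus the `t = 0` law of large numbers); (ii) the three convergences in probability
defining `TendstoHydroFieldsAt … t` hold for every SMOOTH test function `χ` (`Torus.IsSmooth`). Then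
`TendstoHydroFieldsAt P Φ ρ u θ t` holds (all continuous `χ`). Proof: approximate `χ` uniformly by a
smooth `ψ` (`exists_isSmooth_near`); on `{e ≤ K}` the `χ`- and `ψ`-deviations differ by
`O(‖χ - ψ‖_∞ (1 + K))` (`empiricalFields_sub_le`), so `{δ < dev_χ} ⊆ {δ/2 < dev_ψ} ∪ {K < e}`. [folklore] -/
theorem tendstoHydroFieldsAt_of_isSmooth {ε : ℕ → ℝ}
    (P : (N : ℕ) → Measure (Config (N + 1) (Fin 3) T3))
    (Φ : (N : ℕ) → HardSphereFlow (Torus.geometry (Fin 3)) (ε N) (N + 1))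
    (ρ : ℝ → T3 → ℝ) (u : ℝ → T3 → V3) (θ : ℝ → T3 → ℝ) (t : ℝ)
    (hρ : Continuous (ρ t)) (hu : Continuous (u t)) (hθ : Continuous (θ t))
    (htight : ∀ η : ℝ, 0 < η → ∃ K : ℝ, ∃ N₀ : ℕ, ∀ N, N₀ ≤ N →
      P N {z | K < empiricalEnergyField ((Φ N).flow t z) (fun _ => 1)} ≤ ENNReal.ofReal η)
    (h : ∀ χ : T3 → ℝ, Torus.IsSmooth χ → ∀ δ : ℝ, 0 < δ →
      Tendsto (fun N => P N {z | δ < |empiricalDensityField ((Φ N).flow t z) χ -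
        ∫ x, χ x * ρ t x|}) atTop (𝓝 0) ∧
      Tendsto (fun N => P N {z | δ < ‖empiricalMomentumField ((Φ N).flow t z) χ -
        ∫ x, (χ x * ρ t x) • u t x‖}) atTop (𝓝 0) ∧
      Tendsto (fun N => P N {z | δ < |empiricalEnergyField ((Φ N).flow t z) χ -
        ∫ x, χ x * totalEnergyDensity (ρ t x) (u t x) (θ t x)|}) atTop (𝓝 0)) :
    TendstoHydroFieldsAt P Φ ρ u θ t := by
  intro χ hχ δ hδ
  -- bounds of the limit fields
  obtain ⟨Bρ, hBρ0, hBρ⟩ := exists_abs_le_of_continuous_T3 hρ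
  obtain ⟨Bu, hBu0, hBu⟩ := exists_abs_le_of_continuous_T3 (continuous_norm.comp hu)
  have hEc : Continuous fun x => totalEnergyDensity (ρ t x) (u t x) (θ t x) := by
    unfold totalEnergyDensity
    exact hρ.mul (((continuous_norm.comp hu).pow 2).div_const _ |>.add (continuous_const.mul hθ))
  obtain ⟨BE, hBE0, hBE⟩ := exists_abs_le_of_continuous_T3 hEc
  set V : ℝ := ((volume : Measure T3) univ).toReal with hV
  have hV0 : 0 ≤ V := ENNReal.toReal_nonneg
  -- the generic step: given `η`, a smooth `ψ` and the inclusion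
  have key : ∀ η : ℝ, 0 < η → ∃ ψ : T3 → ℝ, Torus.IsSmooth ψ ∧ ∃ K : ℝ, ∃ N₀ : ℕ,
      (∀ N, N₀ ≤ N → P N {z | K < empiricalEnergyField ((Φ N).flow t z) (fun _ => 1)} ≤
        ENNReal.ofReal η) ∧
      ∃ δ' : ℝ, 0 < δ' ∧ (∀ x, |ψ x - χ x| ≤ δ') ∧
        δ' * (1 + (1 / 2 + max K 0) + Bρ * V + Bρ * Bu * V + BE * V) ≤ δ / 2 := by
    intro η hη
    obtain ⟨K, N₀, hK⟩ := htight η hη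
    set M : ℝ := 1 + (1 / 2 + max K 0) + Bρ * V + Bρ * Bu * V + BE * V with hM
    have hM1 : 1 ≤ M := by
      have : 0 ≤ max K 0 := le_max_right _ _
      have h1 : 0 ≤ Bρ * V := mul_nonneg hBρ0 hV0
      have h2 : 0 ≤ Bρ * Bu * V := mul_nonneg (mul_nonneg hBρ0 hBu0) hV0
      have h3 : 0 ≤ BE * V := mul_nonneg hBE0 hV0
      linarith
    have hMpos : 0 < M := by linarith
    obtain ⟨ψ, hψs, hψ⟩ := exists_isSmooth_near hχ (div_pos hδ (mul_pos two_pos hMpos))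
    refine ⟨ψ, hψs, K, N₀, hK, δ / (2 * M), div_pos hδ (mul_pos two_pos hMpos), hψ, ?_⟩
    rw [div_mul_eq_mul_div, div_le_div_iff₀ (mul_pos two_pos hMpos) two_pos]
    nlinarith
  -- integrability of the continuous limit integrands
  have hint : ∀ {f : T3 → ℝ}, Continuous f → Integrable f (volume : Measure T3) := fun hf =>
    hf.integrable_of_hasCompactSupport (HasCompactSupport.of_compactSpace _)
  have hintv : ∀ {f : T3 → V3}, Continuous f → Integrable f (volume : Measure T3) := fun hf =>
    hf.integrable_of_hasCompactSupport (HasCompactSupport.of_compactSpace _)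
  -- limit-side perturbation bounds
  have hlim : ∀ {ψ : T3 → ℝ} {δ' : ℝ}, Torus.IsSmooth ψ → (∀ x, |ψ x - χ x| ≤ δ') →
      |(∫ x, ψ x * ρ t x) - ∫ x, χ x * ρ t x| ≤ δ' * (Bρ * V) ∧
      ‖(∫ x, (ψ x * ρ t x) • u t x) - ∫ x, (χ x * ρ t x) • u t x‖ ≤ δ' * (Bρ * Bu * V) ∧
      |(∫ x, ψ x * totalEnergyDensity (ρ t x) (u t x) (θ t x)) -
        ∫ x, χ x * totalEnergyDensity (ρ t x) (u t x) (θ t x)| ≤ δ' * (BE * V) := by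
    intro ψ δ' hψs hψ
    have hψc : Continuous ψ := hψs.continuous
    have hδ'0 : 0 ≤ δ' := (abs_nonneg _).trans (hψ 0)
    have i1 : Integrable (fun x => ψ x * ρ t x) (volume : Measure T3) := hint (hψc.mul hρ)
    have i2 : Integrable (fun x => χ x * ρ t x) (volume : Measure T3) := hint (hχ.mul hρ)
    have i3 : Integrable (fun x => (ψ x * ρ t x) • u t x) (volume : Measure T3) :=
      hintv ((hψc.mul hρ).smul hu)
    have i4 : Integrable (fun x => (χ x * ρ t x) • u t x) (volume : Measure T3) :=
      hintv ((hχ.mul hρ).smul hu)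
    have i5 : Integrable (fun x => ψ x * totalEnergyDensity (ρ t x) (u t x) (θ t x))
      (volume : Measure T3) := hint (hψc.mul hEc)
    have i6 : Integrable (fun x => χ x * totalEnergyDensity (ρ t x) (u t x) (θ t x))
      (volume : Measure T3) := hint (hχ.mul hEc)
    refine ⟨?_, ?_, ?_⟩
    · rw [← integral_sub i1 i2, ← Real.norm_eq_abs]
      calc _ ≤ δ' * Bρ * V := norm_integral_le_of_norm_le_const (ae_of_all _ fun x => by
              rw [Real.norm_eq_abs, ← sub_mul, abs_mul]
              exact mul_le_mul (hψ x) (hBρ x) (abs_nonneg _) hδ'0)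
        _ = δ' * (Bρ * V) := by ring
    · rw [← integral_sub i3 i4]
      calc _ ≤ δ' * Bρ * Bu * V := norm_integral_le_of_norm_le_const (ae_of_all _ fun x => by
              rw [← sub_smul, norm_smul, Real.norm_eq_abs, ← sub_mul, abs_mul]
              have := hBu x
              simp only [Function.comp_apply, abs_of_nonneg (norm_nonneg _)] at this
              exact mul_le_mul (mul_le_mul (hψ x) (hBρ x) (abs_nonneg _) hδ'0) this
                (norm_nonneg _) (mul_nonneg hδ'0 hBρ0))
        _ = δ' * (Bρ * Bu * V) := by ring
    · rw [← integral_sub i5 i6, ← Real.norm_eq_abs]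
      calc _ ≤ δ' * BE * V := norm_integral_le_of_norm_le_const (ae_of_all _ fun x => by
              rw [Real.norm_eq_abs, ← sub_mul, abs_mul]
              exact mul_le_mul (hψ x) (hBE x) (abs_nonneg _) hδ'0)
        _ = δ' * (BE * V) := by ring
  refine ⟨?_, ?_, ?_⟩
  · -- density
    refine ENNReal.tendsto_zero_of_forall_le_add fun η hη => ?_
    obtain ⟨ψ, hψs, K, N₀, hK, δ', hδ', hψ, hsmall⟩ := key η hη
    refine ⟨fun N => P N {z | δ / 2 < |empiricalDensityField ((Φ N).flow t z) ψ -
        ∫ x, ψ x * ρ t x|}, (h ψ hψs (δ / 2) (half_pos hδ)).1, ?_⟩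
    filter_upwards [eventually_ge_atTop N₀] with N hN
    refine le_trans (measure_mono fun z hz => ?_) ((measure_union_le _ _).trans
      (add_le_add le_rfl (hK N hN)))
    simp only [mem_setOf_eq, mem_union] at hz ⊢
    by_contra hcon
    rw [not_or, not_lt, not_lt] at hcon
    set z' := (Φ N).flow t z
    obtain ⟨hd, -, -⟩ := empiricalFields_sub_le z' hψ
    obtain ⟨hl, -, -⟩ := hlim hψs hψ
    have htri : |empiricalDensityField z' χ - ∫ x, χ x * ρ t x| ≤
        |empiricalDensityField z' ψ - ∫ x, ψ x * ρ t x| +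
        |empiricalDensityField z' ψ - empiricalDensityField z' χ| +
        |(∫ x, ψ x * ρ t x) - ∫ x, χ x * ρ t x| := by
      have e : empiricalDensityField z' χ - ∫ x, χ x * ρ t x =
          (empiricalDensityField z' ψ - ∫ x, ψ x * ρ t x) -
          (empiricalDensityField z' ψ - empiricalDensityField z' χ) +
          ((∫ x, ψ x * ρ t x) - ∫ x, χ x * ρ t x) := by ring
      rw [e]
      refine (abs_add_le _ _).trans (add_le_add ((abs_sub _ _).trans le_rfl) le_rfl)
    have hKmax : (0 : ℝ) ≤ max K 0 := le_max_right _ _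
    have h1 : δ' * 1 + δ' * (Bρ * V) ≤
        δ' * (1 + (1 / 2 + max K 0) + Bρ * V + Bρ * Bu * V + BE * V) := by
      rw [← mul_add]
      refine mul_le_mul_of_nonneg_left ?_ hδ'.le
      nlinarith [mul_nonneg (mul_nonneg hBρ0 hBu0) hV0, mul_nonneg hBE0 hV0]
    linarith [hcon.1, hz, htri, hd, hl]
  · -- momentum
    refine ENNReal.tendsto_zero_of_forall_le_add fun η hη => ?_
    obtain ⟨ψ, hψs, K, N₀, hK, δ', hδ', hψ, hsmall⟩ := key η hη
    refine ⟨fun N => P N {z | δ / 2 < ‖empiricalMomentumField ((Φ N).flow t z) ψ -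
        ∫ x, (ψ x * ρ t x) • u t x‖}, (h ψ hψs (δ / 2) (half_pos hδ)).2.1, ?_⟩
    filter_upwards [eventually_ge_atTop N₀] with N hN
    refine le_trans (measure_mono fun z hz => ?_) ((measure_union_le _ _).trans
      (add_le_add le_rfl (hK N hN)))
    simp only [mem_setOf_eq, mem_union] at hz ⊢
    by_contra hcon
    rw [not_or, not_lt, not_lt] at hcon
    set z' := (Φ N).flow t z
    obtain ⟨-, hm, -⟩ := empiricalFields_sub_le z' hψ
    obtain ⟨-, hl, -⟩ := hlim hψs hψ
    have htri : ‖empiricalMomentumField z' χ - ∫ x, (χ x * ρ t x) • u t x‖ ≤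
        ‖empiricalMomentumField z' ψ - ∫ x, (ψ x * ρ t x) • u t x‖ +
        ‖empiricalMomentumField z' ψ - empiricalMomentumField z' χ‖ +
        ‖(∫ x, (ψ x * ρ t x) • u t x) - ∫ x, (χ x * ρ t x) • u t x‖ := by
      have e : empiricalMomentumField z' χ - ∫ x, (χ x * ρ t x) • u t x =
          (empiricalMomentumField z' ψ - ∫ x, (ψ x * ρ t x) • u t x) -
          (empiricalMomentumField z' ψ - empiricalMomentumField z' χ) +
          ((∫ x, (ψ x * ρ t x) • u t x) - ∫ x, (χ x * ρ t x) • u t x) := by abel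
      rw [e]
      exact (norm_add_le _ _).trans (add_le_add (norm_sub_le _ _) le_rfl)
    have he : empiricalEnergyField z' (fun _ => 1) ≤ max K 0 := hcon.2.trans (le_max_left _ _)
    have hm' : ‖empiricalMomentumField z' ψ - empiricalMomentumField z' χ‖ ≤
        δ' * (1 / 2 + max K 0) :=
      hm.trans (mul_le_mul_of_nonneg_left (by linarith) hδ'.le)
    have h1 : δ' * (1 / 2 + max K 0) + δ' * (Bρ * Bu * V) ≤
        δ' * (1 + (1 / 2 + max K 0) + Bρ * V + Bρ * Bu * V + BE * V) := by
      rw [← mul_add]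
      refine mul_le_mul_of_nonneg_left ?_ hδ'.le
      nlinarith [mul_nonneg hBρ0 hV0, mul_nonneg hBE0 hV0]
    linarith [hcon.1, hz, htri, hm', hl]
  · -- energy
    refine ENNReal.tendsto_zero_of_forall_le_add fun η hη => ?_
    obtain ⟨ψ, hψs, K, N₀, hK, δ', hδ', hψ, hsmall⟩ := key η hη
    refine ⟨fun N => P N {z | δ / 2 < |empiricalEnergyField ((Φ N).flow t z) ψ -
        ∫ x, ψ x * totalEnergyDensity (ρ t x) (u t x) (θ t x)|},
      (h ψ hψs (δ / 2) (half_pos hδ)).2.2, ?_⟩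
    filter_upwards [eventually_ge_atTop N₀] with N hN
    refine le_trans (measure_mono fun z hz => ?_) ((measure_union_le _ _).trans
      (add_le_add le_rfl (hK N hN)))
    simp only [mem_setOf_eq, mem_union] at hz ⊢
    by_contra hcon
    rw [not_or, not_lt, not_lt] at hcon
    set z' := (Φ N).flow t z
    obtain ⟨-, -, hen⟩ := empiricalFields_sub_le z' hψ
    obtain ⟨-, -, hl⟩ := hlim hψs hψ
    have htri : |empiricalEnergyField z' χ - ∫ x, χ x * totalEnergyDensity (ρ t x) (u t x) (θ t x)| ≤
        |empiricalEnergyField z' ψ - ∫ x, ψ x * totalEnergyDensity (ρ t x) (u t x) (θ t x)| +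
        |empiricalEnergyField z' ψ - empiricalEnergyField z' χ| +
        |(∫ x, ψ x * totalEnergyDensity (ρ t x) (u t x) (θ t x)) -
          ∫ x, χ x * totalEnergyDensity (ρ t x) (u t x) (θ t x)| := by
      have e : empiricalEnergyField z' χ - ∫ x, χ x * totalEnergyDensity (ρ t x) (u t x) (θ t x) =
          (empiricalEnergyField z' ψ - ∫ x, ψ x * totalEnergyDensity (ρ t x) (u t x) (θ t x)) -
          (empiricalEnergyField z' ψ - empiricalEnergyField z' χ) +
          ((∫ x, ψ x * totalEnergyDensity (ρ t x) (u t x) (θ t x)) -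
            ∫ x, χ x * totalEnergyDensity (ρ t x) (u t x) (θ t x)) := by ring
      rw [e]
      refine (abs_add_le _ _).trans (add_le_add ((abs_sub _ _).trans le_rfl) le_rfl)
    have he : empiricalEnergyField z' (fun _ => 1) ≤ max K 0 := hcon.2.trans (le_max_left _ _)
    have hen' : |empiricalEnergyField z' ψ - empiricalEnergyField z' χ| ≤ δ' * max K 0 :=
      hen.trans (mul_le_mul_of_nonneg_left he hδ'.le)
    have h1 : δ' * max K 0 + δ' * (BE * V) ≤
        δ' * (1 + (1 / 2 + max K 0) + Bρ * V + Bρ * Bu * V + BE * V) := by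
      rw [← mul_add]
      refine mul_le_mul_of_nonneg_left ?_ hδ'.le
      nlinarith [mul_nonneg hBρ0 hV0, mul_nonneg (mul_nonneg hBρ0 hBu0) hV0]
    linarith [hcon.1, hz, htri, hen', hl]


end Summit.AtomisticToContinuum.HydrodynamicLimit.Theorems
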